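import Summits.ResolutionOfSingularities.ResolutionOfSingularities.Theorems.FrobeniusClosingPatchingRelPerfectDepthPhaseCContactLaws
import HarnessLib

/-!
# Crux `PatchingRelPerfect` (stmt-ResolutionOfSingularities-16161), chain W5.2 — F7(β) (β-AX) PHASE C:
# MACHINE-CHECKED STRICT S1♯ RUNS (chart arithmetic), part 2: (c) the three-host germ W1 = `three_a2b2`

[OURS · L1 W5.2 · F7(β) (β-AX) Phase C · X3 `PhaseCTermination₂` raw material · res-L1-w52-plan-1 ADDENDUM G11-19′ (5) (object named
for res-D-repro-1 AS res-L1-repro-3); res-L1-w52-stub-1's letter-law currency `…DepthPhaseCLetterLaws` (p546570) / `…DepthPhaseCContactLaws` (p548259: the 3-host notation of record,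
`germ₄_factor`, `germ₄_eq_span_of_dvd`) cited for the one-step laws;
res-L1-w52-idea-1 X3 MEASURE MEMO §5.8 (K₃), res-L1-w52-tri-2 TRIAGE v11.6 Row Z4 / kit j283611 (W1 = `three_a2b2`, W2 = the witness `P`),
res-L1-w52-tri-1 TRIAGE v28 Row 0 addendum kit j283591 (K₃: 5 strict moves).]  Replaces the role of NO printed item; NOT a statement of the
manuscript under review (AI-written, weaker than expert review).  Ring level, ANY commutative ring; every identity is an equality of ideals
obtained from the chart substitution of ONE blow-up followed by the division by the exceptional letter ONCE (weight `ν = 1`, the controlled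
transform of spec v4.1 §1 `K_step`), written in the shape `K(substituted) = (exceptional letter) · K′` — or `= (exceptional letter)` when the
controlled transform `K′` is the UNIT ideal (the chart carries no point of `cosupp K′`: END there vacuously), exactly as in `piT_gChart` /
`germ_eq_span_of_dvd` of the letter-law file.  «END» below = the STRICT currency of record (spec §6 A1 `IsFormatSncOn`: all hosts and members
through the point form ONE snc family) read on the final germ: either `K′ = ⊤` on the chart, or `K′` is displayed as a monomial sum in an
exchanged coordinate family (the r.s.o.p. packaging of such a display is the pattern of `…DepthPhaseCLinearTwoPlanePole` §3 /
`…DepthPhaseCCarrierRsop` `isRsopPart_cons_iff`; it is NOT instantiated in this file).  Which centre S1♯ PICKS at each step is the triagers'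
word (move lists quoted per item); this file certifies the arithmetic of the moves and of every chart, nothing about the strategy.  Every move
below is closed by stub-1's 3-host factor law `germ₄_factor` / `germ₄_eq_span_of_dvd` (`…DepthPhaseCContactLaws`) on the concrete letters.

(a) W2 and (b) K₃ are in the sibling file `…DepthPhaseCTailRuns.lean` (two-host germ notation `Kl[…]`); this file is independent of it.

## (c) W1 = tri-2's `three_a2b2` = `(x) + (x + y²) + (x + z²) + (t²)`, member `t` — FULL strict run (tri-2 j283611: «strong S1#-i worst/best 2/2»)
Move 1 (forced: `cosupp = the closed point`): centre `V(x, y, z, t)`; legality `W1_le_centre`; charts `W1_move1_chartX` (`= (x)`), `W1_move1_chartY`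
(`K = (y)·C_y`, `C_y = (x′) + (x′ + y) + (x′ + y z′²) + (y t′²)`, weak-END `C_y = (x′) + (y)` by `W1_childY_weak`, strict non-END), `W1_move1_chartZ`
(symmetric), `W1_move1_chartT` (`K = (t)·C_t`, `C_t = (x′) + (x′ + t y′²) + (x′ + t z′²) + (t)`).  Move 2 on each child = the strip of its unique
cosupp component: `W1_move2_Y_chartY` (`C_y = (y)`: host `x″ + 1` unit), `W1_move2_Y_chartX` (`= (x′)`), the `z`-versions, `W1_move2_T_chartT`
(`C_t = (t)`: the `N`-member becomes `1`), `W1_move2_T_chartX` (`= (x′)`) ⇒ after TWO moves every chart's controlled transform is the unit ideal: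
strict END, = tri-2's depth 2.

What is NOT here: the r.s.o.p./`IsRsopPart` packaging of the END displays; the Rees-chart images (`map_…`, pattern `map_piT_one`); any claim
about which move S1♯ selects (the triagers' tables are quoted, not derived); K₅ / tacnode / diagonal poles; the (α_m) family (stub-1's
`…DepthPhaseCUniaxialLaws`).

## References
* The Stacks Project, Tags 0804, 0BIQ (affine blow-up algebras and their charts). [StacksProject]
* J. Kollár, *Lectures on Resolution of Singularities* (2007), (3.111) Step 3 (monomial bookkeeping). [Kollar2007]
-/

-- `Summit.<Summit>.<Sub>.Theorems` with `Sub = Summit` (single-conjunct summit, D-0017)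
set_option linter.dupNamespace false

noncomputable section

open Literature.AlgebraicGeometry.Resolution

namespace Summit.ResolutionOfSingularities.ResolutionOfSingularities.Theorems

universe u

namespace DepthPhaseC

/-- The three-host germ `K = (g) + (g + φ₂) + (g + φ₃) + (n)` (W1). -/
local notation3 "Kq[" g "," φ "," χ "," n "]" => (Ideal.span {g} ⊔ Ideal.span {g + φ} ⊔ Ideal.span {g + χ} ⊔ Ideal.span {n})

section Algebra

variable {A : Type u} [CommRing A]

/-! ## §0 Glue for the three-host germ (the factor law `germ₄_factor`, `germ₄_eq_span_of_dvd` and the notation of record are res-L1-w52-stub-1's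
`…DepthPhaseCContactLaws`, imported; here only the unit / weak-END leaves) -/

/-- **Unit leaf (three hosts)**: a unit host letter `g + w`, `w` a unit, makes the germ the unit ideal. [folklore] -/
theorem germ₄_eq_top_of_isUnit (g χ n : A) {w : A} (hw : IsUnit w) : Kq[g, w, χ, n] = ⊤ := by
  rw [Ideal.eq_top_iff_one]
  obtain ⟨v, hv⟩ := hw.exists_left_inv
  have : v * (g + w) - v * g = 1 := by rw [← hv]; ring
  rw [← this]
  exact Ideal.sub_mem _
    (Ideal.mem_sup_left (Ideal.mem_sup_left (Ideal.mem_sup_right (Ideal.mul_mem_left _ _ (Ideal.mem_span_singleton_self _)))))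
    (Ideal.mem_sup_left (Ideal.mem_sup_left (Ideal.mem_sup_left (Ideal.mul_mem_left _ _ (Ideal.mem_span_singleton_self _)))))

/-- **Unit leaf (three hosts, third host)**: a unit third-host letter `g + w` makes the germ the unit ideal. [folklore] -/
theorem germ₄_eq_top_of_isUnit₃ (g φ n : A) {w : A} (hw : IsUnit w) : Kq[g, φ, w, n] = ⊤ := by
  rw [Ideal.eq_top_iff_one]
  obtain ⟨v, hv⟩ := hw.exists_left_inv
  have : v * (g + w) - v * g = 1 := by rw [← hv]; ring
  rw [← this]
  exact Ideal.sub_mem _ (Ideal.mem_sup_left (Ideal.mem_sup_right (Ideal.mul_mem_left _ _ (Ideal.mem_span_singleton_self _))))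
    (Ideal.mem_sup_left (Ideal.mem_sup_left (Ideal.mem_sup_left (Ideal.mul_mem_left _ _ (Ideal.mem_span_singleton_self _)))))

/-- **Unit leaf via the `N`-member (three hosts)**: if the `N`-summand is a unit the germ is the unit ideal. [folklore] -/
theorem germ₄_eq_top_of_isUnit_N (g φ χ : A) {n : A} (hn : IsUnit n) : Kq[g, φ, χ, n] = ⊤ := by
  rw [Ideal.eq_top_iff_one]
  obtain ⟨v, hv⟩ := hn.exists_left_inv
  rw [← hv]
  exact Ideal.mem_sup_right (Ideal.mul_mem_left _ _ (Ideal.mem_span_singleton_self _))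

/-- **Weak-END display (three hosts)**: if `φ = m` is a letter dividing `χ` and `n`, the germ is `(g) + (m)`. [folklore] -/
theorem germ₄_eq_of_dvd (g m χ' n' : A) : Kq[g, m, m * χ', m * n'] = Ideal.span {g} ⊔ Ideal.span {m} := by
  refine le_antisymm (sup_le (sup_le (sup_le le_sup_left ?_) ?_) ?_) (sup_le (le_sup_of_le_left (le_sup_of_le_left le_sup_left)) ?_) <;>
    rw [Ideal.span_singleton_le_iff_mem]
  · exact Ideal.add_mem _ (Ideal.mem_sup_left (Ideal.mem_span_singleton_self g)) (Ideal.mem_sup_right (Ideal.mem_span_singleton_self m))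
  · exact Ideal.add_mem _ (Ideal.mem_sup_left (Ideal.mem_span_singleton_self g))
      (Ideal.mem_sup_right (Ideal.mem_span_singleton.mpr ⟨χ', rfl⟩))
  · exact Ideal.mem_sup_right (Ideal.mem_span_singleton.mpr ⟨n', rfl⟩)
  · have h : g + m - g ∈ (Kq[g, m, m * χ', m * n'] : Ideal A) :=
      Ideal.sub_mem _ (Ideal.mem_sup_left (Ideal.mem_sup_left (Ideal.mem_sup_right (Ideal.mem_span_singleton_self _))))
        (Ideal.mem_sup_left (Ideal.mem_sup_left (Ideal.mem_sup_left (Ideal.mem_span_singleton_self _))))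
    rwa [add_sub_cancel_left] at h

/-! ## §1 (c) W1 — three pairwise tangent hosts `(x) + (x + y²) + (x + z²) + (t²)`, member `t` -/

/-- **Legality of move 1 (`ν = 1`)**: `W1 ≤ (x, y, z, t)`. [folklore] -/
theorem W1_le_centre (x y z t : A) : Kq[x, y ^ 2, z ^ 2, t ^ 2] ≤ Ideal.span (Set.range ![x, y, z, t]) := by
  have hx : x ∈ Ideal.span (Set.range ![x, y, z, t]) := Ideal.subset_span ⟨0, rfl⟩
  have hy : y ∈ Ideal.span (Set.range ![x, y, z, t]) := Ideal.subset_span ⟨1, rfl⟩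
  have hz : z ∈ Ideal.span (Set.range ![x, y, z, t]) := Ideal.subset_span ⟨2, rfl⟩
  have ht : t ∈ Ideal.span (Set.range ![x, y, z, t]) := Ideal.subset_span ⟨3, rfl⟩
  refine sup_le (sup_le (sup_le ?_ ?_) ?_) ?_ <;> rw [Ideal.span_singleton_le_iff_mem]
  · exact hx
  · exact Ideal.add_mem _ hx (by rw [pow_two]; exact Ideal.mul_mem_left _ _ hy)
  · exact Ideal.add_mem _ hx (by rw [pow_two]; exact Ideal.mul_mem_left _ _ hz)
  · rw [pow_two]; exact Ideal.mul_mem_left _ _ ht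

/-- **W1 move 1, `x`-chart** (`y = x y′`, `z = x z′`, `t = x t′`): the germ is `(x)` (END on this chart). [folklore] -/
theorem W1_move1_chartX (x y' z' t' : A) : Kq[x, (x * y') ^ 2, (x * z') ^ 2, (x * t') ^ 2] = Ideal.span {x} := by
  rw [show (x * y') ^ 2 = x * (x * y' ^ 2) by ring, show (x * z') ^ 2 = x * (x * z' ^ 2) by ring,
    show (x * t') ^ 2 = x * (x * t' ^ 2) by ring, germ₄_eq_span_of_dvd]

/-- **W1 move 1, `y`-chart** (`x = y x′`, `z = y z′`, `t = y t′`): `W1 = (y) · C_y`, `C_y = (x′) + (x′ + y) + (x′ + y z′²) + (y t′²)`.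
[folklore] -/
theorem W1_move1_chartY (x' y z' t' : A) :
    Kq[y * x', y ^ 2, (y * z') ^ 2, (y * t') ^ 2] = Ideal.span {y} * Kq[x', y, y * z' ^ 2, y * t' ^ 2] := by
  rw [show y ^ 2 = y * y by ring, show (y * z') ^ 2 = y * (y * z' ^ 2) by ring, show (y * t') ^ 2 = y * (y * t' ^ 2) by ring,
    germ₄_factor]

/-- **The child `C_y` is WEAK-END**: `C_y = (x′) + (y)` (strictly NOT END at its origin: `x′, x′ + y, x′ + y z′², y` are dependent —
tri-2 v11.6 Z4 «the child of the forced point move is weak-END»). [folklore] -/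
theorem W1_childY_weak (x' y z' t' : A) : Kq[x', y, y * z' ^ 2, y * t' ^ 2] = Ideal.span {x'} ⊔ Ideal.span {y} :=
  germ₄_eq_of_dvd x' y (z' ^ 2) (t' ^ 2)

/-- **W1 move 1, `z`-chart** (`x = z x′`, `y = z y′`, `t = z t′`): `W1 = (z) · C_z`, `C_z = (x′) + (x′ + z y′²) + (x′ + z) + (z t′²)`
(tri-2 j283611's displayed child). [folklore] -/
theorem W1_move1_chartZ (x' y' z t' : A) :
    Kq[z * x', (z * y') ^ 2, z ^ 2, (z * t') ^ 2] = Ideal.span {z} * Kq[x', z * y' ^ 2, z, z * t' ^ 2] := by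
  rw [show (z * y') ^ 2 = z * (z * y' ^ 2) by ring, show z ^ 2 = z * z by ring, show (z * t') ^ 2 = z * (z * t' ^ 2) by ring,
    germ₄_factor]

/-- **The child `C_z` is WEAK-END**: `C_z = (x′) + (z)`. [folklore] -/
theorem W1_childZ_weak (x' y' z t' : A) : Kq[x', z * y' ^ 2, z, z * t' ^ 2] = Ideal.span {x'} ⊔ Ideal.span {z} := by
  refine le_antisymm (sup_le (sup_le (sup_le le_sup_left ?_) ?_) ?_) (sup_le (le_sup_of_le_left (le_sup_of_le_left le_sup_left)) ?_) <;>
    rw [Ideal.span_singleton_le_iff_mem]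
  · exact Ideal.add_mem _ (Ideal.mem_sup_left (Ideal.mem_span_singleton_self _))
      (Ideal.mem_sup_right (Ideal.mem_span_singleton.mpr ⟨y' ^ 2, by ring⟩))
  · exact Ideal.add_mem _ (Ideal.mem_sup_left (Ideal.mem_span_singleton_self _)) (Ideal.mem_sup_right (Ideal.mem_span_singleton_self _))
  · exact Ideal.mem_sup_right (Ideal.mem_span_singleton.mpr ⟨t' ^ 2, by ring⟩)
  · have h : x' + z - x' ∈ (Kq[x', z * y' ^ 2, z, z * t' ^ 2] : Ideal A) :=
      Ideal.sub_mem _ (Ideal.mem_sup_left (Ideal.mem_sup_right (Ideal.mem_span_singleton_self _)))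
        (Ideal.mem_sup_left (Ideal.mem_sup_left (Ideal.mem_sup_left (Ideal.mem_span_singleton_self _))))
    rwa [add_sub_cancel_left] at h

/-- **W1 move 1, `t`-chart** (`x = t x′`, `y = t y′`, `z = t z′`): `W1 = (t) · C_t`, `C_t = (x′) + (x′ + t y′²) + (x′ + t z′²) + (t)`.
[folklore] -/
theorem W1_move1_chartT (x' y' z' t : A) :
    Kq[t * x', (t * y') ^ 2, (t * z') ^ 2, t ^ 2] = Ideal.span {t} * Kq[x', t * y' ^ 2, t * z' ^ 2, t] := by
  rw [show (t * y') ^ 2 = t * (t * y' ^ 2) by ring, show (t * z') ^ 2 = t * (t * z' ^ 2) by ring, show t ^ 2 = t * t by ring,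
    germ₄_factor]

/-- **The child `C_t` is WEAK-END**: `C_t = (x′) + (t)` (three hosts pairwise tangent along `V(x′, t)`; strictly NOT END). [folklore] -/
theorem W1_childT_weak (x' y' z' t : A) : Kq[x', t * y' ^ 2, t * z' ^ 2, t] = Ideal.span {x'} ⊔ Ideal.span {t} := by
  refine le_antisymm (sup_le (sup_le (sup_le le_sup_left ?_) ?_) le_sup_right)
    (sup_le (le_sup_of_le_left (le_sup_of_le_left le_sup_left)) le_sup_right) <;> rw [Ideal.span_singleton_le_iff_mem]
  · exact Ideal.add_mem _ (Ideal.mem_sup_left (Ideal.mem_span_singleton_self _))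
      (Ideal.mem_sup_right (Ideal.mem_span_singleton.mpr ⟨y' ^ 2, by ring⟩))
  · exact Ideal.add_mem _ (Ideal.mem_sup_left (Ideal.mem_span_singleton_self _))
      (Ideal.mem_sup_right (Ideal.mem_span_singleton.mpr ⟨z' ^ 2, by ring⟩))

/-- **W1 move 2 on `C_y` = `Π_y`, `y`-chart** (`x′ = y x″`): `C_y = (y) · ((x″) + (x″ + 1) + (x″ + z′²) + (t′²)) = (y)` — the second host is the
unit `x″ + 1`: the controlled transform is `⊤`, no point of `cosupp` (END). [folklore] -/
theorem W1_move2_Y_chartY (x'' y z' t' : A) : Kq[y * x'', y, y * z' ^ 2, y * t' ^ 2] = Ideal.span {y} := by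
  have h := germ₄_factor y x'' 1 (z' ^ 2) (t' ^ 2)
  rw [mul_one] at h
  rw [h, germ₄_eq_top_of_isUnit _ _ _ isUnit_one, Ideal.mul_top]

/-- **W1 move 2 on `C_y`, `x′`-chart** (`y = x′ y″`): `C_y = (x′)` (END). [folklore] -/
theorem W1_move2_Y_chartX (x' y'' z' t' : A) :
    Kq[x', x' * y'', x' * y'' * z' ^ 2, x' * y'' * t' ^ 2] = Ideal.span {x'} := by
  rw [show x' * y'' * z' ^ 2 = x' * (y'' * z' ^ 2) by ring, show x' * y'' * t' ^ 2 = x' * (y'' * t' ^ 2) by ring, germ₄_eq_span_of_dvd]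

/-- **W1 move 2 on `C_z` = `Π_z`, `z`-chart** (`x′ = z x″`): `C_z = (z)` (the third host is the unit `x″ + 1`; END). [folklore] -/
theorem W1_move2_Z_chartZ (x'' y' z t' : A) : Kq[z * x'', z * y' ^ 2, z, z * t' ^ 2] = Ideal.span {z} := by
  have h := germ₄_factor z x'' (y' ^ 2) 1 (t' ^ 2)
  rw [mul_one] at h
  rw [h, germ₄_eq_top_of_isUnit₃ _ _ _ isUnit_one, Ideal.mul_top]

/-- **W1 move 2 on `C_z`, `x′`-chart** (`z = x′ z″`): `C_z = (x′)` (END). [folklore] -/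
theorem W1_move2_Z_chartX (x' y' z'' t' : A) :
    Kq[x', x' * z'' * y' ^ 2, x' * z'', x' * z'' * t' ^ 2] = Ideal.span {x'} := by
  rw [show x' * z'' * y' ^ 2 = x' * (z'' * y' ^ 2) by ring, show x' * z'' * t' ^ 2 = x' * (z'' * t' ^ 2) by ring, germ₄_eq_span_of_dvd]

/-- **W1 move 2 on `C_t` = `Π_t`, `t`-chart** (`x′ = t x″`): `C_t = (t) · ((x″) + (x″ + y′²) + (x″ + z′²) + (1)) = (t)` — the `N`-member has
become `1`: the controlled transform is `⊤` (END). [folklore] -/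
theorem W1_move2_T_chartT (x'' y' z' t : A) : Kq[t * x'', t * y' ^ 2, t * z' ^ 2, t] = Ideal.span {t} := by
  have h := germ₄_factor t x'' (y' ^ 2) (z' ^ 2) 1
  rw [mul_one] at h
  rw [h, germ₄_eq_top_of_isUnit_N _ _ _ isUnit_one, Ideal.mul_top]

/-- **W1 move 2 on `C_t`, `x′`-chart** (`t = x′ t″`): `C_t = (x′)` (END). [folklore] -/
theorem W1_move2_T_chartX (x' y' z' t'' : A) :
    Kq[x', x' * t'' * y' ^ 2, x' * t'' * z' ^ 2, x' * t''] = Ideal.span {x'} := by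
  rw [show x' * t'' * y' ^ 2 = x' * (t'' * y' ^ 2) by ring, show x' * t'' * z' ^ 2 = x' * (t'' * z' ^ 2) by ring, germ₄_eq_span_of_dvd]

end Algebra

end DepthPhaseC

end Summit.ResolutionOfSingularities.ResolutionOfSingularities.Theorems

end
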